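import Mathlib
import Literature.AlgebraicGeometry.Resolution.ChartTwoVertex
import Literature.AlgebraicGeometry.Resolution.BoundedPreparation
import HarnessLib

/-!
# Total preparedness is symmetric in `u₁ ↔ u₂` (OPTION R, swap packet)

Topic: `Literature/AlgebraicGeometry/Resolution`. V. Cossart, U. Jannsen, S. Saito, LNM 2270 (2020),
Definition 11.1 and the picture below it (the characteristic polygon reflected in the diagonal under
`u₁ ↔ u₂`), Cor. 8.17 / Thm. 8.24 («prepared at all vertices») [cite: CossartJannsenSaito2020, Cor. 8.17];
V. Cossart, O. Piltant, J. Algebra 320 (2008), §4 p. 11 («`Δ(E; u₁, u₂; y)` is prepared if no vertex is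
solvable») [cite: CossartPiltant2008, Prop. 4.4].

OURS (swap packet of the completed-chain descent R-5): the bounded notion `PreparedUpTo c J μ B` of
`BoundedPreparation` is NOT symmetric (its bound is on the abscissa), but preparedness at EVERY vertex is:
`(∀ B, PreparedUpTo c J μ B) → ∀ B, PreparedUpTo (c ∘ σ₁₂) J μ B` (and back by the involution), via the
equivariance of Newton points, level weights and solvability under the transposition `σ₁₂`
(`PolygonSymmetry`, `ChartTwoVertex.isSolvableAt_comp_σ₁₂_iff`). No facts, no definitions.
F-71 / T1 / N2 NOT proved; no summit statement is proved. AI-written; weaker than expert review.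
-/

noncomputable section

open IsLocalRing MvPolynomial

namespace Literature.AlgebraicGeometry.Resolution

universe u

section Swap

variable {R : Type u} [CommRing R] [IsRegularLocalRing R] (c : Fin 3 → R)
  (hgen : Ideal.span {c 0, c 1, c 2} = maximalIdeal R) (hdim : ringKrullDim R = 3)
  {J : Ideal R} {μ : ℕ}

omit [IsRegularLocalRing R] in
/-- Level weights under the swap: `(w₀, L p₂, L p₁) ∘ σ = (w₀, L p₁, L p₂)`. [cite: CossartJannsenSaito2020, Def. 11.1] -/
theorem levelWeight_comp_σ₁₂ (μ w₀ p₁ p₂ : ℕ) :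
    levelWeight μ w₀ p₂ p₁ ∘ σ₁₂ = levelWeight μ w₀ p₁ p₂ := by
  funext i; fin_cases i <;> rfl

omit [IsRegularLocalRing R] in
/-- `eswap (vexp b a) = vexp a b`. [cite: CossartJannsenSaito2020, Def. 11.1] -/
theorem eswap_vexp (a b : ℕ) : eswap (vexp b a) = vexp a b := by
  ext i; fin_cases i <;> simp

include hgen hdim in
/-- **Preparedness at every vertex passes to the swapped label `c ∘ σ₁₂`.**
[cite: CossartJannsenSaito2020, Cor. 8.17] [cite: CossartPiltant2008, Prop. 4.4] -/
theorem preparedUpTo_forall_comp_σ₁₂ (hprep : ∀ B, PreparedUpTo c J μ B) :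
    ∀ B, PreparedUpTo (c ∘ σ₁₂) J μ B := by
  intro B w₀ p₁ p₂ hw₀ hp₁ hp₂ hS v₁ v₂ _hB hline hreal huniq lam
  -- the swapped data for `c`
  have hS' : ∀ e ∈ pts c J μ, w₀ ≤ p₂ * spt₁ μ e + p₁ * spt₂ μ e := by
    intro e he
    have h := hS (eswap e) ((mem_pts_comp_σ₁₂_iff c J μ _).mpr (by rwa [eswap_eswap]))
    rw [spt₁_eswap, spt₂_eswap] at h
    omega
  have hreal' : ∃ e ∈ pts c J μ, spt₁ μ e = μ.factorial * v₂ ∧ spt₂ μ e = μ.factorial * v₁ := by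
    obtain ⟨e, he, he1, he2⟩ := hreal
    refine ⟨eswap e, (mem_pts_comp_σ₁₂_iff c J μ e).mp he, ?_, ?_⟩
    · rw [spt₁_eswap]; exact he2
    · rw [spt₂_eswap]; exact he1
  have huniq' : ∀ e ∈ pts c J μ, p₂ * spt₁ μ e + p₁ * spt₂ μ e = w₀ →
      spt₁ μ e = μ.factorial * v₂ ∧ spt₂ μ e = μ.factorial * v₁ := by
    intro e he h
    have h' := huniq (eswap e) ((mem_pts_comp_σ₁₂_iff c J μ _).mpr (by rwa [eswap_eswap]))
    rw [spt₁_eswap, spt₂_eswap] at h'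
    have := h' (by omega)
    exact ⟨this.2, this.1⟩
  have hline' : w₀ = μ.factorial * (p₂ * v₂ + p₁ * v₁) := by rw [hline]; ring
  have hnot := hprep (μ.factorial * v₂) w₀ p₂ p₁ hw₀ hp₂ hp₁ hS' v₂ v₁ le_rfl hline' hreal' huniq' lam
  -- transport along `σ₁₂`
  intro hsol
  apply hnot
  have hw : ∀ i, 0 < levelWeight μ w₀ p₂ p₁ i := levelWeight_pos hw₀ hp₂ hp₁
  rw [← isSolvableAt_comp_σ₁₂_iff c hgen hdim J hw (w₀ * μ) μ (vexp v₂ v₁) lam,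
    levelWeight_comp_σ₁₂, eswap_vexp]
  exact hsol

include hgen hdim in
/-- **Preparedness at every vertex is symmetric in `u₁ ↔ u₂`.** [cite: CossartJannsenSaito2020, Cor. 8.17]
[cite: CossartPiltant2008, Prop. 4.4] -/
theorem preparedUpTo_forall_comp_σ₁₂_iff :
    (∀ B, PreparedUpTo (c ∘ σ₁₂) J μ B) ↔ ∀ B, PreparedUpTo c J μ B := by
  refine ⟨fun h => ?_, preparedUpTo_forall_comp_σ₁₂ c hgen hdim⟩
  have hgen' : Ideal.span {(c ∘ σ₁₂) 0, (c ∘ σ₁₂) 1, (c ∘ σ₁₂) 2} = maximalIdeal R := by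
    rw [span_triple_comp_σ₁₂]; exact hgen
  have := preparedUpTo_forall_comp_σ₁₂ (c ∘ σ₁₂) hgen' hdim h
  rwa [comp_σ₁₂_comp_σ₁₂] at this

end Swap

end Literature.AlgebraicGeometry.Resolution

end
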